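import Literature.AnabelianGeometry.EtaleTheta.TemperedCoveringsProofs
import Literature.AnabelianGeometry.AbsoluteAnabelian.AbsTopI.CoFreeCompletionDense

/-!
# [EtTh] Def. 3.3 (i)(b)/(ii): the `Δ^fil`-closures `Δ^{fil,∞}_i ⊆ Δ^tp_X` are NORMAL in `Π^tp_X`

S. Mochizuki, *The étale theta function …*, Publ. RIMS **45** (2009) [MochizukiEtTh2009], §3 Def. 3.3 (i)(b), PDF p.72:
«Every `Δ^fil_i` admits a minimal co-free subgroup `Δ^{fil,∞}_i` [which is necessarily characteristic as a subgroup of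
`Δ`]»; Def. 3.3 (ii) p.73: the `Δ^fil`-covering `Z^log_∞ → X^log` «corresponds to the subgroup `Δ^{fil,∞}_i ⊆ Δ^tp_X`» —
a covering of `X^log`, Galois because that subgroup is normal in `Π^tp_X` [cite: MochizukiEtTh2009, Def 3.3 (i) p.72].

abc-iut cell, layer L2; seat abc-iut-L2-t3 (gen 5), owner of Def. 3.3 (i)–(ii) (`TemperedFilter`, `TemperedFilterOn`).
PROOF-ONLY (0 defs); nothing landed is edited.  Inputs BY NAME: abc-iut-L6-t12's `TemperedFilter.isTopCharacteristic_closure`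
(the printed bracket: `Δ^{fil,∞}_i` characteristic in `Δ`, `TemperedCoveringsProofs.lean`) and abc-iut-L4's
`normal_of_map_conjRestrict_eq` ([AbsTopI] §0: a subgroup of the normal `Δ` invariant under all topological automorphisms
of `Δ` is normal in `Π`, conjugation restricting to `Δ`).
* `TemperedFilter.isTopCharacteristic_filClosure` — the `Δ^fil`-closure of an open subgroup is characteristic in `Δ`;
* `TemperedFilterOn.closure_subgroupOf` — bookkeeping: `Δ^{fil,∞}_i` viewed in `Π^tp_X` and back;
* **`TemperedFilterOn.closure_normal`** — `Δ^{fil,∞}_i ⊴ Π^tp_X`; `TemperedFilterOn.filClosure_normal` — same for the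
  `Δ^fil`-closure of an open subgroup of `Δ^tp_X`.
This is the input «`Δ^{fil,∞}_i ⊴ Π`» (`LevelSystem.closure_normal`) of the v2 Def. 3.3 (iii) datum (FOUNDATIONS row
«LogDivisorModel v2 (covering-indexed Mero)», abc-iut-L2-lead R342/R387; design memo
`HOME/staging/L2/L2-t3/VNEXT-LogDivisorModelV2-DESIGN.md`).  HONEST FRAMING: refereed pre-IUT material; group theory over the
typed interface; typed ≠ proved — here proved; nothing here bears on the disputed [IUTchIII] Cor. 3.12.
-/

namespace Literature.AnabelianGeometry.EtaleTheta

open Literature.AnabelianGeometry.SemiGraphs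

universe u

namespace TemperedFilter

variable {Δ : Type u} [Group Δ] [TopologicalSpace Δ] (F : TemperedFilter Δ)

/-- The `Δ^fil`-closure of an open subgroup `H ⊆ Δ` is characteristic in `Δ` (it is `Δ^{fil,∞}_{i_H}`;
abc-iut-L6-t12's `isTopCharacteristic_closure`). [cite: MochizukiEtTh2009, Def 3.3 (i) p.72] -/
theorem isTopCharacteristic_filClosure (H : OpenSubgroup Δ) : IsTopCharacteristic Δ (F.filClosure H) :=
  F.isTopCharacteristic_closure (F.indexOf H)

end TemperedFilter

namespace TemperedFilterOn

variable {K : Type u} [Field K] (X : SemiGraphs.TemperedArithmeticGroup K) (F : TemperedFilterOn X)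

/-- `Δ^{fil,∞}_i` viewed inside `Π^tp_X` (as `(F.closure i).map Δ^tp_X.subtype`) and restricted back to `Δ^tp_X` is
`Δ^{fil,∞}_i`. [cite: MochizukiEtTh2009, Def 3.3 (ii) p.73] -/
theorem closure_subgroupOf (i : F.I) : ((F.closure i).map X.delta.subtype).subgroupOf X.delta = F.closure i :=
  Subgroup.comap_map_eq_self_of_injective (Subgroup.subtype_injective X.delta) (F.closure i)

/-- **Def. 3.3 (i)(b)/(ii): `Δ^{fil,∞}_i` is NORMAL in `Π^tp_X`** — it is characteristic in the normal subgroup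
`Δ^tp_X = Ker(Π^tp_X ↠ G_K)`, and conjugation by an element of `Π^tp_X` restricts to a topological automorphism of
`Δ^tp_X`.  (So the `Δ^fil`-covering `Z^log_∞ → X^log` of Def. 3.3 (ii) is Galois with group `Π^tp_X / Δ^{fil,∞}_i`.)
[cite: MochizukiEtTh2009, Def 3.3 (ii) p.73] -/
theorem closure_normal (i : F.I) : ((F.closure i).map X.delta.subtype).Normal :=
  AbsoluteAnabelian.AbsTopI.normal_of_map_conjRestrict_eq (Subgroup.map_subtype_le _) fun α => by
    rw [closure_subgroupOf]
    exact F.isTopCharacteristic_closure i α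

/-- The `Δ^fil`-closure of an open subgroup of `Δ^tp_X`, viewed in `Π^tp_X`, is normal in `Π^tp_X`.
[cite: MochizukiEtTh2009, Def 3.3 (ii) p.73] -/
theorem filClosure_normal (H : OpenSubgroup X.delta) : ((F.filClosure H).map X.delta.subtype).Normal :=
  closure_normal X F (F.indexOf H)

/-- In particular for the geometric part of an open subgroup `H ⊆ Π^tp_X` (a connected tempered covering `Y^log`): the
subgroup of `Π^tp_X` of the `Δ^fil`-closure `Z^log_∞ → Y^log` is normal in `Π^tp_X`. [cite: MochizukiEtTh2009, Def 3.3 (ii) p.73] -/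
theorem filClosure_geometricPart_normal (H : OpenSubgroup X.Pi) :
    ((F.filClosure (geometricPart H)).map X.delta.subtype).Normal :=
  filClosure_normal X F (geometricPart H)

end TemperedFilterOn

end Literature.AnabelianGeometry.EtaleTheta
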